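import Mathlib.AlgebraicGeometry.EllipticCurve.DivisionPolynomial.Basic
import Literature.NumberTheory.EllipticCurves.DivisionPolynomialTorsion
import Summits.BirchSwinnertonDyer.Rank1Residual.GaloisImage.NineDivisionFrobeniusCertificate
import HarnessLib

/-!
# BirchSwinnertonDyer — rank-2 `Ш[p^∞]` cell, STRUCTURE track: `φₙ(x(T))` is an `n`-th power for `T` of order `n = 5, 7`

HONEST FRAMING (cell `b2b-bsdr2sha`, run/shared/lean/b2b/bsd-rank2-sha/, STRUCTURE.md /
structure/THEORY-NOTE-C5.md supplement 4): an ELEMENTARY identity between Mathlib's division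
polynomials of a Weierstrass curve over any commutative ring, and its consequence at points of order
`5`. It is the case `n = 5` of the cell's «Theorem A» in its numerical form
`φₙ(x(T)) = m^{2n}`, `m = ψ₂(T)·∏_{i=2}^{(n−1)/2} (x(T) − x(iT))` — for `n = 5`, `m = Ψ₃(x_T)/ψ₂(T)`, so
`φ₅(x(T))·ψ₂(T)¹⁰ = Ψ₃(x_T)¹⁰` — i.e. the SPLIT HALF of the cell's conjecture C7 at the prime `p = 5`
(the largest anomalous cell of the census): `φ₅(x(T))` is a fifth power for `T` of order `5`; and the
same at `n = 7` (`m = ψ₂(T)·preΨ₄(x_T)/Ψ₃(x_T) = ψ₄(T)/ψ₃(T)`, `φ₇(x(T))·Ψ₃(x_T)¹⁴ = ψ₄(T)¹⁴`). In general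
the product telescopes, `x(T) − x(iT) = ψ_{i−1}ψ_{i+1}/ψ_i²` giving `m = ψ_{k+1}(T)/ψ_k(T)` for `n = 2k+1`,
so the numerical form of Theorem A reads `φₙ(x_T)·ψ_k(T)^{2n} = ψ_{k+1}(T)^{2n}`. Nothing here concerns
BSD, `Ш`, or any census number; no definition, no named fact, no hypothesis beyond Mathlib's.
Companion of `Theorems/Rank2ShaPhiThreeCube.lean` (`n = 3`).

THE CERTIFICATE (why no large computation is needed). Write `A = preΨ₄·Ψ₂Sq²`, `B = Ψ₃³`; Mathlib's
recursion gives `Ψ₅ := preΨ'₅ = A − B`, `preΨ'₆ = Ψ₃·(Ψ₅ − preΨ₄²)` and `Φ₅ = X·Ψ₅² − preΨ'₆·preΨ₄·Ψ₂Sq`.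
Hence `Φ₅·Ψ₂Sq⁵ − Ψ₃¹⁰ = Ψ₅·(X·Ψ₅·Ψ₂Sq⁵ − Ψ₃·preΨ₄·Ψ₂Sq⁶) + Ψ₃·(A³ − B³)` and `A³ − B³ = (A − B)(A² + AB + B²)`
with `A − B = Ψ₅`: so `Φ₅·Ψ₂Sq⁵ − Ψ₃¹⁰ = Ψ₅ · Q₅` with the explicit
`Q₅ = X·Ψ₅·Ψ₂Sq⁵ − Ψ₃·preΨ₄·Ψ₂Sq⁶ + Ψ₃·(A² + AB + B²)` (a polynomial of degree `28` in `X`; an independent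
exact long division in `ℤ[b₂,b₄,b₆,b₈][X]`, 627 terms, remainder `0`, confirmed it — work file
`divpoly5.py` of the P2 seat). REMARKABLY the certificates for `n = 5, 7` (and `11, 13`) live in the FREE
ring `ℤ[X, Ψ₂Sq, Ψ₃, preΨ₄]` generated by Mathlib's recursion (no relation between the atoms is used;
`n = 3` and `n = 9` do need the curve relation `preΨ₄ + Ψ₂Sq² = (6X² + b₂X + b₄)Ψ₃`): for `n = 7`,
`Φ₇·Ψ₃¹⁴ − Ψ₂Sq⁷·preΨ₄¹⁴ = Ψ₇·Q₇` with a 15-term `Q₇` (below; found by exact division in the free atom ring,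
work file `atomsN.py`, and re-verified here by `ring`).

CONTENT.
* `Φ_five` : the `n = 5` instance of Mathlib's `Φ_ofNat`; the recursion instances `preΨ'₅ = preΨ₄·Ψ₂Sq² − Ψ₃³`,
  `preΨ'₆ = Ψ₃·preΨ'₅ − Ψ₃·preΨ₄²` are REUSED from the tree (`…Rank1Residual.GaloisImage.Frob9.preΨ'_five/_six`,
  Summits/BirchSwinnertonDyer/Rank1Residual/GaloisImage/NineDivisionFrobeniusCertificate.lean), not restated.
* `Φ_five_mul_Ψ₂Sq_pow_five_sub_Ψ₃_pow_ten` : `Φ₅·Ψ₂Sq⁵ − Ψ₃¹⁰ = Ψ₅·Q₅` in `R[X]` (any `CommRing R`).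
* `eval_Φ_five_mul_eq_of_eval_preΨ'_five` : at a root `x` of `Ψ₅`, `Φ₅(x)·Ψ₂Sq(x)⁵ = Ψ₃(x)¹⁰`.
* `eval_Φ_five_mul_ψ₂_pow_ten_of_evalEval_ψ_five` : over a field, for an affine point `(x, y)` of the
  curve with `ψ₅(x, y) = 0`: `Φ₅(x)·ψ₂(x, y)¹⁰ = Ψ₃(x)¹⁰`; and `eval_Φ_five_eq_pow_five_of_evalEval_ψ_five` :
  if moreover `ψ₂(x, y) ≠ 0` (the point is not `2`-torsion) then `Φ₅(x) = (Ψ₃(x)²/ψ₂(x, y)²)⁵` is a FIFTH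
  POWER (tree: `WeierstrassCurve.evalEval_ψ_sq`, Silverman AEC Exercise 3.7(a); Mathlib `ΨSq_ofNat`).
* `preΨ'_seven`, `preΨ'_eight`, `Φ_seven`, `Φ_seven_mul_Ψ₃_pow_fourteen_sub` (`Φ₇·Ψ₃¹⁴ − Ψ₂Sq⁷·preΨ₄¹⁴ =
  Ψ₇·Q₇`), `preΨ'_seven_dvd`, `eval_Φ_seven_mul_eq_of_eval_preΨ'_seven`,
  `eval_Φ_seven_mul_Ψ₃_pow_fourteen_of_evalEval_ψ_seven` (on the curve with `ψ₇(x,y) = 0`: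
  `Φ₇(x)·Ψ₃(x)¹⁴ = (ψ₂(x,y)·preΨ₄(x))¹⁴`) and `eval_Φ_seven_eq_pow_seven_of_evalEval_ψ_seven` (if
  `Ψ₃(x) ≠ 0`: `Φ₇(x) = ((ψ₂(x,y)·preΨ₄(x))²/Ψ₃(x)²)⁷`, a SEVENTH POWER).

References: J. H. Silverman, *The Arithmetic of Elliptic Curves* (2009), Exercise 3.7
[SilvermanAEC2009]; Mathlib `Mathlib/AlgebraicGeometry/EllipticCurve/DivisionPolynomial/Basic.lean`.
-/

set_option autoImplicit false

-- single-conjunct summit: `Summit.BirchSwinnertonDyer.BirchSwinnertonDyer.…` repeats the name by design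
set_option linter.dupNamespace false

open Polynomial
open Summit.BirchSwinnertonDyer.Rank1Residual.GaloisImage (Frob9.preΨ'_five Frob9.preΨ'_six)

namespace Summit.BirchSwinnertonDyer.BirchSwinnertonDyer.Rank2Sha.Structure

section Ring

variable {R : Type*} [CommRing R] (W : WeierstrassCurve R)

/-- Mathlib's `Φ_ofNat` at `n = 5`: `Φ₅ = X·Ψ₅² − preΨ'₆·preΨ₄·Ψ₂Sq`. -/
theorem Φ_five : W.Φ 5 = X * W.preΨ' 5 ^ 2 - W.preΨ' 6 * W.preΨ₄ * W.Ψ₂Sq := by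
  have h := W.Φ_ofNat 4
  have h4 : Even 4 := by decide
  simp only [Nat.reduceAdd, if_pos h4, mul_one, WeierstrassCurve.preΨ'_four] at h
  exact_mod_cast h

/-- **Theorem A of the cell's STRUCTURE note at `n = 5`, polynomial form**: in `R[X]`, for every
Weierstrass curve over a commutative ring `R`,
`Φ₅·Ψ₂Sq⁵ − Ψ₃¹⁰ = Ψ₅·(X·Ψ₅·Ψ₂Sq⁵ − Ψ₃·preΨ₄·Ψ₂Sq⁶ + Ψ₃·((preΨ₄·Ψ₂Sq²)² + (preΨ₄·Ψ₂Sq²)·Ψ₃³ + Ψ₃⁶))`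
(`Ψ₅ = preΨ'₅`). In particular `Ψ₅ ∣ Φ₅·Ψ₂Sq⁵ − Ψ₃¹⁰`: the numerator `Φ₅(x)` of `x(5P)` times `ψ₂(P)¹⁰`
is congruent to the tenth power `Ψ₃(x)¹⁰` modulo the `5`-division polynomial. The proof is the
difference-of-cubes certificate described in the module docstring (`ring` on the recursion). -/
theorem Φ_five_mul_Ψ₂Sq_pow_five_sub_Ψ₃_pow_ten :
    W.Φ 5 * W.Ψ₂Sq ^ 5 - W.Ψ₃ ^ 10 =
      W.preΨ' 5 * (X * W.preΨ' 5 * W.Ψ₂Sq ^ 5 - W.Ψ₃ * W.preΨ₄ * W.Ψ₂Sq ^ 6 +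
        W.Ψ₃ * ((W.preΨ₄ * W.Ψ₂Sq ^ 2) ^ 2 + (W.preΨ₄ * W.Ψ₂Sq ^ 2) * W.Ψ₃ ^ 3 + W.Ψ₃ ^ 6)) := by
  rw [Φ_five, Frob9.preΨ'_six, Frob9.preΨ'_five]
  ring

/-- `Ψ₅` divides `Φ₅·Ψ₂Sq⁵ − Ψ₃¹⁰` in `R[X]`. -/
theorem preΨ'_five_dvd : W.preΨ' 5 ∣ W.Φ 5 * W.Ψ₂Sq ^ 5 - W.Ψ₃ ^ 10 :=
  Dvd.intro _ (Φ_five_mul_Ψ₂Sq_pow_five_sub_Ψ₃_pow_ten W).symm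

/-- At a root `x` of the `5`-division polynomial `Ψ₅ = preΨ'₅`: `Φ₅(x)·Ψ₂Sq(x)⁵ = Ψ₃(x)¹⁰`. -/
theorem eval_Φ_five_mul_eq_of_eval_preΨ'_five {x : R} (hx : (W.preΨ' 5).eval x = 0) :
    (W.Φ 5).eval x * ((W.Ψ₂Sq).eval x) ^ 5 = ((W.Ψ₃).eval x) ^ 10 := by
  have h := congrArg (Polynomial.eval x) (Φ_five_mul_Ψ₂Sq_pow_five_sub_Ψ₃_pow_ten W)
  simp only [eval_sub, eval_pow, eval_mul, hx, zero_mul] at h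
  linear_combination h

/-! ### `n = 7` -/

/-- Mathlib's recursion at `n = 7`: `Ψ₇ = preΨ'₇ = Ψ₅·Ψ₃³ − preΨ₄³·Ψ₂Sq²` (`ψ₇ = ψ₅ψ₃³ − ψ₂ψ₄³`). -/
theorem preΨ'_seven : W.preΨ' 7 = W.preΨ' 5 * W.Ψ₃ ^ 3 - W.preΨ₄ ^ 3 * W.Ψ₂Sq ^ 2 := by
  have h := W.preΨ'_odd 1
  have h1 : ¬ Even 1 := by decide
  simp only [Nat.reduceAdd, Nat.reduceMul, if_neg h1, mul_one, WeierstrassCurve.preΨ'_two,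
    WeierstrassCurve.preΨ'_three, WeierstrassCurve.preΨ'_four, one_mul] at h
  exact h

/-- Mathlib's recursion at `n = 8`: `preΨ'₈ = Ψ₃²·preΨ₄·preΨ'₆ − preΨ₄·Ψ₅²`. -/
theorem preΨ'_eight : W.preΨ' 8 = W.Ψ₃ ^ 2 * W.preΨ₄ * W.preΨ' 6 - W.preΨ₄ * W.preΨ' 5 ^ 2 := by
  have h := W.preΨ'_even 1
  simp only [Nat.reduceAdd, Nat.reduceMul, WeierstrassCurve.preΨ'_two, WeierstrassCurve.preΨ'_three,
    WeierstrassCurve.preΨ'_four, one_mul] at h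
  exact h

/-- Mathlib's `Φ_ofNat` at `n = 7`: `Φ₇ = X·Ψ₇² − preΨ'₈·preΨ'₆·Ψ₂Sq`. -/
theorem Φ_seven : W.Φ 7 = X * W.preΨ' 7 ^ 2 - W.preΨ' 8 * W.preΨ' 6 * W.Ψ₂Sq := by
  have h := W.Φ_ofNat 6
  have h6 : Even 6 := by decide
  simp only [Nat.reduceAdd, if_pos h6, mul_one] at h
  exact_mod_cast h

/-- **Theorem A of the cell's STRUCTURE note at `n = 7`, polynomial form**: in `R[X]`, for every
Weierstrass curve over a commutative ring `R`, `Φ₇·Ψ₃¹⁴ − Ψ₂Sq⁷·preΨ₄¹⁴ = Ψ₇·Q₇` (`Ψ₇ = preΨ'₇`) with the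
explicit 15-term `Q₇ ∈ ℤ[X, Ψ₂Sq, Ψ₃, preΨ₄]` displayed in the statement. In particular
`Ψ₇ ∣ Φ₇·Ψ₃¹⁴ − Ψ₂Sq⁷·preΨ₄¹⁴`: the numerator `Φ₇(x)` of `x(7P)` times `ψ₃(P)¹⁴` is congruent to
`ψ₄(P)¹⁴ = (ψ₂(P)·preΨ₄(x))¹⁴` modulo the `7`-division polynomial. Proof: `ring` on Mathlib's recursion
(the identity holds in the free ring on the atoms `X, Ψ₂Sq, Ψ₃, preΨ₄`). -/
theorem Φ_seven_mul_Ψ₃_pow_fourteen_sub :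
    W.Φ 7 * W.Ψ₃ ^ 14 - W.Ψ₂Sq ^ 7 * W.preΨ₄ ^ 14 =
      W.preΨ' 7 * (X * W.preΨ' 7 * W.Ψ₃ ^ 14
        + W.Ψ₂Sq ^ 5 * (W.Ψ₃ ^ 12 * W.preΨ₄ ^ 3 + W.Ψ₃ ^ 9 * W.preΨ₄ ^ 5 + W.Ψ₃ ^ 6 * W.preΨ₄ ^ 7
            + W.Ψ₃ ^ 3 * W.preΨ₄ ^ 9 + W.preΨ₄ ^ 11)
        - W.Ψ₂Sq ^ 3 * (3 * W.Ψ₃ ^ 15 * W.preΨ₄ ^ 2 + 3 * W.Ψ₃ ^ 12 * W.preΨ₄ ^ 4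
            + 2 * W.Ψ₃ ^ 9 * W.preΨ₄ ^ 6 + W.Ψ₃ ^ 6 * W.preΨ₄ ^ 8)
        + W.Ψ₂Sq * (2 * W.Ψ₃ ^ 18 * W.preΨ₄ + 3 * W.Ψ₃ ^ 15 * W.preΨ₄ ^ 3
            + W.Ψ₃ ^ 12 * W.preΨ₄ ^ 5)) := by
  rw [Φ_seven, preΨ'_eight, preΨ'_seven, Frob9.preΨ'_six, Frob9.preΨ'_five]
  ring

/-- `Ψ₇` divides `Φ₇·Ψ₃¹⁴ − Ψ₂Sq⁷·preΨ₄¹⁴` in `R[X]`. -/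
theorem preΨ'_seven_dvd : W.preΨ' 7 ∣ W.Φ 7 * W.Ψ₃ ^ 14 - W.Ψ₂Sq ^ 7 * W.preΨ₄ ^ 14 :=
  Dvd.intro _ (Φ_seven_mul_Ψ₃_pow_fourteen_sub W).symm

/-- At a root `x` of the `7`-division polynomial `Ψ₇ = preΨ'₇`: `Φ₇(x)·Ψ₃(x)¹⁴ = Ψ₂Sq(x)⁷·preΨ₄(x)¹⁴`. -/
theorem eval_Φ_seven_mul_eq_of_eval_preΨ'_seven {x : R} (hx : (W.preΨ' 7).eval x = 0) :
    (W.Φ 7).eval x * ((W.Ψ₃).eval x) ^ 14 = ((W.Ψ₂Sq).eval x) ^ 7 * ((W.preΨ₄).eval x) ^ 14 := by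
  have h := congrArg (Polynomial.eval x) (Φ_seven_mul_Ψ₃_pow_fourteen_sub W)
  simp only [eval_sub, eval_pow, eval_mul, hx, zero_mul] at h
  linear_combination h

end Ring

section Field

variable {K : Type*} [Field K] (V : WeierstrassCurve K)

/-- Over a field: for an affine point `(x, y)` ON the curve with `ψ₅(x, y) = 0` (Mathlib's genuine
bivariate `5`-division polynomial `WeierstrassCurve.ψ 5`), `Φ₅(x)·ψ₂(x, y)¹⁰ = Ψ₃(x)¹⁰`, where
`ψ₂ = 2y + a₁x + a₃`. (On the curve `ψ₅(x,y)² = ΨSq₅(x) = Ψ₅(x)²` and `ψ₂(x,y)² = Ψ₂Sq(x)` — tree lemma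
`WeierstrassCurve.evalEval_ψ_sq`, Silverman AEC Exercise 3.7(a).) -/
theorem eval_Φ_five_mul_ψ₂_pow_ten_of_evalEval_ψ_five {x y : K} (h : V.toAffine.Equation x y)
    (h5 : (V.ψ 5).evalEval x y = 0) :
    (V.Φ 5).eval x * ((V.ψ 2).evalEval x y) ^ 10 = ((V.Ψ₃).eval x) ^ 10 := by
  have hΨ₅ : (V.preΨ' 5).eval x = 0 := by
    have e := V.evalEval_ψ_sq h 5
    have hΨSq : V.ΨSq 5 = V.preΨ' 5 ^ 2 := by
      have h5odd : ¬ Even 5 := by decide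
      simpa [h5odd] using V.ΨSq_ofNat 5
    rw [h5, hΨSq, eval_pow] at e
    have e' : ((V.preΨ' 5).eval x) ^ 2 = 0 := by simpa using e.symm
    exact pow_eq_zero_iff two_ne_zero |>.mp e'
  have hsq : ((V.ψ 2).evalEval x y) ^ 2 = (V.Ψ₂Sq).eval x := by
    rw [V.evalEval_ψ_sq h 2, WeierstrassCurve.ΨSq_two]
  have hmain := eval_Φ_five_mul_eq_of_eval_preΨ'_five V hΨ₅
  calc (V.Φ 5).eval x * ((V.ψ 2).evalEval x y) ^ 10
      = (V.Φ 5).eval x * (((V.ψ 2).evalEval x y) ^ 2) ^ 5 := by ring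
    _ = ((V.Ψ₃).eval x) ^ 10 := by rw [hsq]; exact hmain

/-- **Theorem A at `n = 5` (cell STRUCTURE note), evaluated form — the SPLIT HALF of C7 at `p = 5`.**
Over a field, for an affine point `P = (x, y)` on the curve with `ψ₅(P) = 0` and `ψ₂(P) ≠ 0` (so `P` has
order `5`), the numerator of `x(5P)` at `x(P)` is a FIFTH power:
`Φ₅(x) = (Ψ₃(x)² / ψ₂(x, y)²)⁵` (`= κ_P⁵`, `κ_P = (Ψ₃(x_P)/ψ₂(P))²`). -/
theorem eval_Φ_five_eq_pow_five_of_evalEval_ψ_five {x y : K} (h : V.toAffine.Equation x y)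
    (h5 : (V.ψ 5).evalEval x y = 0) (h2 : (V.ψ 2).evalEval x y ≠ 0) :
    (V.Φ 5).eval x = (((V.Ψ₃).eval x) ^ 2 / ((V.ψ 2).evalEval x y) ^ 2) ^ 5 := by
  have hmain := eval_Φ_five_mul_ψ₂_pow_ten_of_evalEval_ψ_five V h h5
  have hu : ((V.ψ 2).evalEval x y) ^ 10 ≠ 0 := pow_ne_zero 10 h2
  rw [div_pow, ← pow_mul, ← pow_mul, show 2 * 5 = 10 by norm_num, eq_div_iff hu, hmain]

/-- Over a field: for an affine point `(x, y)` ON the curve with `ψ₇(x, y) = 0`,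
`Φ₇(x)·Ψ₃(x)¹⁴ = (ψ₂(x, y)·preΨ₄(x))¹⁴` (`ψ₂·preΨ₄ = ψ₄`; on the curve `ψ₇² = Ψ₇²`, `ψ₂² = Ψ₂Sq` — tree lemma
`WeierstrassCurve.evalEval_ψ_sq`). -/
theorem eval_Φ_seven_mul_Ψ₃_pow_fourteen_of_evalEval_ψ_seven {x y : K} (h : V.toAffine.Equation x y)
    (h7 : (V.ψ 7).evalEval x y = 0) :
    (V.Φ 7).eval x * ((V.Ψ₃).eval x) ^ 14 = ((V.ψ 2).evalEval x y * (V.preΨ₄).eval x) ^ 14 := by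
  have hΨ₇ : (V.preΨ' 7).eval x = 0 := by
    have e := V.evalEval_ψ_sq h 7
    have hΨSq : V.ΨSq 7 = V.preΨ' 7 ^ 2 := by
      have h7odd : ¬ Even 7 := by decide
      simpa [h7odd] using V.ΨSq_ofNat 7
    rw [h7, hΨSq, eval_pow] at e
    have e' : ((V.preΨ' 7).eval x) ^ 2 = 0 := by simpa using e.symm
    exact pow_eq_zero_iff two_ne_zero |>.mp e'
  have hsq : ((V.ψ 2).evalEval x y) ^ 2 = (V.Ψ₂Sq).eval x := by
    rw [V.evalEval_ψ_sq h 2, WeierstrassCurve.ΨSq_two]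
  have hmain := eval_Φ_seven_mul_eq_of_eval_preΨ'_seven V hΨ₇
  calc (V.Φ 7).eval x * ((V.Ψ₃).eval x) ^ 14
      = ((V.Ψ₂Sq).eval x) ^ 7 * ((V.preΨ₄).eval x) ^ 14 := hmain
    _ = (((V.ψ 2).evalEval x y) ^ 2) ^ 7 * ((V.preΨ₄).eval x) ^ 14 := by rw [hsq]
    _ = ((V.ψ 2).evalEval x y * (V.preΨ₄).eval x) ^ 14 := by ring

/-- **Theorem A at `n = 7` (cell STRUCTURE note), evaluated form — the SPLIT HALF of C7 at `p = 7`.**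
Over a field, for an affine point `P = (x, y)` on the curve with `ψ₇(P) = 0` and `Ψ₃(x) ≠ 0` (`P` is not
`3`-torsion), the numerator of `x(7P)` at `x(P)` is a SEVENTH power:
`Φ₇(x) = ((ψ₂(x, y)·preΨ₄(x))² / Ψ₃(x)²)⁷` (`= κ_P⁷`, `κ_P = (ψ₄(P)/ψ₃(P))²`). -/
theorem eval_Φ_seven_eq_pow_seven_of_evalEval_ψ_seven {x y : K} (h : V.toAffine.Equation x y)
    (h7 : (V.ψ 7).evalEval x y = 0) (h3 : (V.Ψ₃).eval x ≠ 0) :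
    (V.Φ 7).eval x = (((V.ψ 2).evalEval x y * (V.preΨ₄).eval x) ^ 2 / ((V.Ψ₃).eval x) ^ 2) ^ 7 := by
  have hmain := eval_Φ_seven_mul_Ψ₃_pow_fourteen_of_evalEval_ψ_seven V h h7
  have hu : ((V.Ψ₃).eval x) ^ 14 ≠ 0 := pow_ne_zero 14 h3
  rw [div_pow, ← pow_mul, ← pow_mul, show 2 * 7 = 14 by norm_num, eq_div_iff hu, hmain]

end Field

end Summit.BirchSwinnertonDyer.BirchSwinnertonDyer.Rank2Sha.Structure
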